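import Summits.KontsevichZagierPeriods.KontsevichZagierPeriods.Theorems.RootDecompWalshStrataParab4Baker
import Summits.KontsevichZagierPeriods.KontsevichZagierPeriods.Theorems.RootDecompWalshStrataCone4Baker

/-!
# The weight-one sector of the `d = 4` rung: what is DECIDED

Route `RootDecompWalshStrata` (cell decomp-kz, lens 4, gen 11), support toward `QuadricSignKernel`
(item stmt-KontsevichZagierPeriods-25393).  The `d = 4` node reads
`QuadricFour ⟸ RationalTwoKernel ∧ QuadricTwoDescent` (`RootDecompWalshStrataQuadricFourRung`).  This file
records the WEIGHT SPLIT of the four `d = 4` specimens and what it decides outright: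

* WEIGHT ONE (descent to a rational 1-cell inside the rules ⇒ Conjecture 1 in kernel form HOLDS by
  Baker, NO oracle): the solid paraboloid (`bakerDescentAt_parab4`), the Lorentzian cone
  (`bakerDescentAt_cone4`), every cylinder over a `d = 3` quadric (given the proved support
  `QuadricBakerDescent`), and the images of these under coordinate permutations and box reflections;
  for any family drawn from this class the kernel statement of `QuadricSignKernel` is a THEOREM
  (`sum_mem_relations_four_of_bakerDescentAt`).
* WEIGHT TWO (descent to a rational 2-cell: `(0,1)²`-valued in `ℚπ²`): the 4-ball (`π²/32`) and the
  split quadric (`π²/12 − 3/4`); there the oracle `RationalTwoKernel` (= KZ in dimension two on the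
  closure of rational 2-cells, i.e. containing "`π²` is not a `ℚ`-combination of `1, π, log`-values of
  the Baker sector" — open) stays load-bearing.

The node therefore sharpens to `QuadricFour ⟸ RationalTwoKernel ∧ (every quadric 4-cell has weight one
OR weight two)` (`quadricFour_of_twoKernel_of_weightSplit`).  0 sorry.
[KontsevichZagier2001 §1.2; Baker1975 Thm 2.1; this node]
-/

noncomputable section

open Literature.NumberTheory.Transcendental
open MvPolynomial (rename bind₁)
open Summit.KontsevichZagierPeriods.KontsevichZagierPeriods.Theses.RootDecompWalshStrata
  (QuadricBakerDescent)
open Summit.KontsevichZagierPeriods.RootDecompWalshStrata.BakerAt (QuadricBakerDescentAt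
  sum_mem_relations_of_bakerDescentAt twoDescentFourAt_of_bakerDescentAt bakerDescentAt_rename
  bakerDescentAt_reflect bakerDescentAt_cylinder_four)
open Summit.KontsevichZagierPeriods.RootDecompWalshStrata.Parab4 (parab4Poly bakerDescentAt_parab4)
open Summit.KontsevichZagierPeriods.RootDecompWalshStrata.Cone4 (cone4Poly bakerDescentAt_cone4)

namespace Summit.KontsevichZagierPeriods.RootDecompWalshStrata.QuadricFourRung

/-! #### The kernel statement on the weight-one class is a theorem -/

/-- **Conjecture 1 (kernel form) for weight-one quadric 4-cells, unconditionally:** if every quadric of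
the family descends inside the rules to the Baker sector (`QuadricBakerDescentAt`), every vanishing
`ℤ`-combination of the constant-weight cells `[(0,1)⁴ ∩ {Pᵢ > 0}, qᵢ]` is a Kontsevich–Zagier relation.
[Baker1975 Thm 2.1; KontsevichZagier2001 §1.2; this node] -/
theorem sum_mem_relations_four_of_bakerDescentAt (k : ℕ) (P : Fin k → MvPolynomial (Fin 4) ℚ)
    (q : Fin k → ℚ) (ρ : Fin k → KZ.IntegralRep 4) (c : Fin k → ℤ)
    (hW : ∀ i, QuadricBakerDescentAt (P i))
    (hρ : ∀ i, (ρ i).domain = {x | (∀ j, 0 < x j ∧ x j < 1) ∧ 0 < MvPolynomial.aeval x (P i)} ∧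
      ∀ x ∈ (ρ i).domain, (ρ i).integrand x = (q i : ℝ))
    (hdeg : ∀ i, (P i).totalDegree ≤ 2) (hv : KZ.eval (∑ i, c i • KZ.of (ρ i)) = 0) :
    (∑ i, c i • KZ.of (ρ i)) ∈ KZ.relations :=
  sum_mem_relations_of_bakerDescentAt k (fun _ => 4) P q ρ c hW hρ hdeg hv

/-! #### Generators of the certified weight-one class and their orbits -/

/-- Every coordinate permutation of the paraboloid has weight one. [this node] -/
theorem bakerDescentAt_parab4_rename (σ : Equiv.Perm (Fin 4)) :
    QuadricBakerDescentAt (rename σ parab4Poly) :=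
  bakerDescentAt_rename σ bakerDescentAt_parab4

/-- Every coordinate permutation of the cone has weight one. [this node] -/
theorem bakerDescentAt_cone4_rename (σ : Equiv.Perm (Fin 4)) :
    QuadricBakerDescentAt (rename σ cone4Poly) :=
  bakerDescentAt_rename σ bakerDescentAt_cone4

/-- Every box reflection `xⱼ ↦ 1 − xⱼ` of the paraboloid has weight one (e.g. the cap
`{1 − x₃ > x₀² + x₁² + x₂²}`). [this node] -/
theorem bakerDescentAt_parab4_reflect (j : Fin 4) :
    QuadricBakerDescentAt (bind₁ (KZ.reflectSubst j) parab4Poly) :=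
  bakerDescentAt_reflect j totalDegree_parab4Poly_le bakerDescentAt_parab4

/-- Every box reflection of the cone has weight one (e.g. the cone with apex at a far corner).
[this node] -/
theorem bakerDescentAt_cone4_reflect (j : Fin 4) :
    QuadricBakerDescentAt (bind₁ (KZ.reflectSubst j) cone4Poly) :=
  bakerDescentAt_reflect j totalDegree_cone4Poly_le bakerDescentAt_cone4

/-- Permutations of reflections of the paraboloid have weight one. [this node] -/
theorem bakerDescentAt_parab4_rename_reflect (σ : Equiv.Perm (Fin 4)) (j : Fin 4) :
    QuadricBakerDescentAt (rename σ (bind₁ (KZ.reflectSubst j) parab4Poly)) :=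
  bakerDescentAt_rename σ (bakerDescentAt_parab4_reflect j)

/-- Permutations of reflections of the cone have weight one. [this node] -/
theorem bakerDescentAt_cone4_rename_reflect (σ : Equiv.Perm (Fin 4)) (j : Fin 4) :
    QuadricBakerDescentAt (rename σ (bind₁ (KZ.reflectSubst j) cone4Poly)) :=
  bakerDescentAt_rename σ (bakerDescentAt_cone4_reflect j)

/-! #### Unconditional kernel statements for mixed paraboloid / cone families -/

/-- **Conjecture 1 (kernel form) HOLDS, unconditionally, for every family of constant-weight 4-cells cut
out by coordinate permutations of the paraboloid `x₃ > x₀² + x₁² + x₂²` and of the cone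
`x₃² > x₀² + x₁² + x₂²`** (any mixture, any rational weights).
[Baker1975 Thm 2.1; KontsevichZagier2001 §1.2; this node] -/
theorem sum_mem_relations_parab4_cone4 (k : ℕ) (P : Fin k → MvPolynomial (Fin 4) ℚ)
    (q : Fin k → ℚ) (ρ : Fin k → KZ.IntegralRep 4) (c : Fin k → ℤ)
    (hP : ∀ i, ∃ σ : Equiv.Perm (Fin 4), P i = rename σ parab4Poly ∨ P i = rename σ cone4Poly)
    (hρ : ∀ i, (ρ i).domain = {x | (∀ j, 0 < x j ∧ x j < 1) ∧ 0 < MvPolynomial.aeval x (P i)} ∧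
      ∀ x ∈ (ρ i).domain, (ρ i).integrand x = (q i : ℝ))
    (hv : KZ.eval (∑ i, c i • KZ.of (ρ i)) = 0) : (∑ i, c i • KZ.of (ρ i)) ∈ KZ.relations := by
  refine sum_mem_relations_four_of_bakerDescentAt k P q ρ c (fun i => ?_) hρ (fun i => ?_) hv
  · obtain ⟨σ, h | h⟩ := hP i
    · rw [h]; exact bakerDescentAt_parab4_rename σ
    · rw [h]; exact bakerDescentAt_cone4_rename σ
  · obtain ⟨σ, h | h⟩ := hP i
    · rw [h]; exact (MvPolynomial.totalDegree_rename_le _ _).trans totalDegree_parab4Poly_le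
    · rw [h]; exact (MvPolynomial.totalDegree_rename_le _ _).trans totalDegree_cone4Poly_le

/-- **Kernel form for mixed paraboloid / cone / cylinder families**, given the PROVED support statement
`QuadricBakerDescent` (item 27597): cylinders `{g(x_{σ0}, x_{σ1}, x_{σ2}) > 0}` over `d = 3` quadrics
join the class. [Baker1975 Thm 2.1; KontsevichZagier2001 §1.2; this node] -/
theorem sum_mem_relations_parab4_cone4_cylinder (hB : QuadricBakerDescent) (k : ℕ)
    (P : Fin k → MvPolynomial (Fin 4) ℚ) (q : Fin k → ℚ) (ρ : Fin k → KZ.IntegralRep 4)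
    (c : Fin k → ℤ)
    (hP : ∀ i, ∃ σ : Equiv.Perm (Fin 4), P i = rename σ parab4Poly ∨ P i = rename σ cone4Poly ∨
      ∃ g : MvPolynomial (Fin 3) ℚ, g.totalDegree ≤ 2 ∧ P i = rename σ (rename Fin.castSucc g))
    (hρ : ∀ i, (ρ i).domain = {x | (∀ j, 0 < x j ∧ x j < 1) ∧ 0 < MvPolynomial.aeval x (P i)} ∧
      ∀ x ∈ (ρ i).domain, (ρ i).integrand x = (q i : ℝ))
    (hv : KZ.eval (∑ i, c i • KZ.of (ρ i)) = 0) : (∑ i, c i • KZ.of (ρ i)) ∈ KZ.relations := by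
  refine sum_mem_relations_four_of_bakerDescentAt k P q ρ c (fun i => ?_) hρ (fun i => ?_) hv
  · obtain ⟨σ, h | h | ⟨g, hg, h⟩⟩ := hP i
    · rw [h]; exact bakerDescentAt_parab4_rename σ
    · rw [h]; exact bakerDescentAt_cone4_rename σ
    · rw [h]; exact bakerDescentAt_cylinder_four hB g hg σ
  · obtain ⟨σ, h | h | ⟨g, hg, h⟩⟩ := hP i
    · rw [h]; exact (MvPolynomial.totalDegree_rename_le _ _).trans totalDegree_parab4Poly_le
    · rw [h]; exact (MvPolynomial.totalDegree_rename_le _ _).trans totalDegree_cone4Poly_le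
    · rw [h]
      exact (MvPolynomial.totalDegree_rename_le _ _).trans
        ((MvPolynomial.totalDegree_rename_le _ _).trans hg)

/-! #### The sharpened node: the oracle is needed only off the weight-one class -/

/-- **NODE (weight split).** `QuadricFour` follows from the dimension-two oracle `RationalTwoKernel`, the
PROVED support `QuadricBakerDescent` (all `d ≤ 3` cells have weight one) and the dichotomy "every
quadric 4-cell has weight one (`QuadricBakerDescentAt`) or weight two (`QuadricTwoDescentFourAt`)";
the four specimens realise both branches (paraboloid, cone : one; ball, split : two).
[KontsevichZagier2001 §1.2; this node] -/
theorem quadricFour_of_twoKernel_of_weightSplit (hK : RationalTwoKernel) (hB : QuadricBakerDescent)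
    (h : ∀ P : MvPolynomial (Fin 4) ℚ, QuadricBakerDescentAt P ∨ QuadricTwoDescentFourAt P) :
    QuadricFour :=
  quadricFour_of_twoKernel_of_bakerDescent_of_four hK hB
    (quadricTwoDescentFour_iff_forall_at.mpr fun P =>
      (h P).elim twoDescentFourAt_of_bakerDescentAt id)

end Summit.KontsevichZagierPeriods.RootDecompWalshStrata.QuadricFourRung

end
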